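import Summits.CriticalPhenomena.SAWScalingLimit.Theses.SAWExcursionCardy
import Summits.CriticalPhenomena.SAWScalingLimit.Theorems.SAWLoopFugacityFlowSimpleSubseqLimitsFarReturnLine
import Literature.Probability.LatticeModels.SRWPathSpace
import HarnessLib.Audit

/-!
# Birth skeleton — ORDER child `LatticeFarReturnDecay` of crux `SimpleSubseqLimits`
(route `SAWExcursionCardy`, lattice split of stmt-CriticalPhenomena-4514 by crux strategist r1 [A], 2026-08-17)

LINE `far-return-brownian-domination` — LSW04 §3.4.5 made quantitative on the lattice: "after its
first entrance into a ball, the critical SAW approaches the far part of its own past no more than a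
random-walk excursion in the slit graph does — and, averaged over the walk's own past, that excursion
does not". The ORDER child

`LatticeFarReturnDecay := ∀ D a b, IsEndpointApprox D a b → ∀ q r θ, … ∃ ε r₀ r', … ∀ᶠ δ → 0⁺,
   P_δ[thickened far first-hit return at (q, r₀, r, r', ε)] ≤ θ`   (= `FarPast.Passage.FarReturnDecay`)

is reached through its landed sufficient form `PastFutureAvoidance` (past/future return AT THE FIRST
ENTRANCE into `B̄(q, r')`, `r' ≤ 5r`; `FarPast.Line.farReturnDecay_of_pastFutureAvoidance`) from TWO
stubs stated for ONE explicit lattice quantity `rwFar D δ a_δ b_δ q r r' ε' γ`: for a lattice SAW `γ`,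
let `k` be the index of its first vertex in `B̄(q, r')`, `P` the set of vertices before `k` (the past,
tip excluded), `F ⊆ P` the vertices visited before the walk first came `5r`-close to `q` (the FAR past);
`rwFar` is the probability that simple random walk from the tip `γ_k`, run along the edges of the SLIT
GRAPH `Ω_δ ∖ P` and stopped at its first arrival at `b_δ`, passes `ε'`-close (in the plane) to a far-past
vertex — the random-walk excursion of the slit domain started at the tip, an explicit killed-walk
quantity (no conformal map; `0` if `γ` never enters the ball).

* `stub_farReturnDomination : FarReturnDomination` — HÖLDER-WEAK, PAST-AVERAGED BROWNIAN DOMINATION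
  AT THE FIRST ENTRANCE (research-open; the `x_c`-specific input): constants `C, θ₀ > 0` such that for
  every Dobrushin domain, endpoint approximation and `(q, r, r', ε)` with `r < r' ≤ 5r`, eventually in `δ`,
  `P_δ[past/future return at the first entrance into B̄(q, r')] ≤ C · (E_δ[rwFar(2ε)])^{θ₀}`.
  By exact domain Markov (landed `StubForbiddenDomainMarkov`) the left side is `E_δ[P^{slit}_{SAW}(future
  ε-approaches the far past)]`, so the stub is implied (Jensen, `θ₀ ≤ 1`) by the per-past domination
  `P^{slit}_{SAW}[hit A] ≤ C · P^{slit}_{RW-exc}[hit A]^{θ₀}` of idea card `brownian-domination-simple-limits`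
  restricted to the targets `A` = thickened far pasts; continuum sanity: restriction exponents `5/8 < 1`
  give the sharp form with `C = θ₀ = 1` in every simply connected slit domain (LSW03). Stated AVERAGED over
  the past under `P_δ` (uniform-over-pasts lattice statements are false: a past can gate the target,
  Disproof.lean §14; in this currency a gating past forces the excursion too, so no ring-road witness applies).
* `stub_rwFarDecay : RWFarDecay` — THE PAST-AVERAGED EXCURSION DOES NOT RETURN TO THE FAR PAST (open but
  of a different kind): for every `(q, r, η)` there are `ε` and `r' ∈ (r, 5r]` with `E_δ[rwFar(2ε)] ≤ η`
  eventually. For each FIXED past whose slit domain keeps the tip macroscopically connected to `b`, the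
  excursion from the tip approaches the far slit with probability `→ 0` as `ε → 0` (Beurling / harmonic
  measure in the slit domain, uniform lattice potential theory à la Kozdron–Lawler 2005 — this route's own
  toolbox, cf. `MartinRatioBoundaryLimit`); the average can fail to vanish only through pasts that CAGE
  their own tip at vanishing width with non-vanishing probability — a special, one-strand pinch event of the
  past alone. HONEST CAVEAT: that caging bound is itself an order-type statement about the critical SAW; the
  line TRANSFERS the two-strand future/past estimate to (domination) + (a one-strand caging estimate), it does
  not dissolve it.

COMPOSITION (PROVED, arithmetic + landed lemmas): `η = (θ/C)^{1/θ₀}`, the `(ε, r')` of stub 2, chain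
`P_δ ≤ C · E^{θ₀} ≤ C · η^{θ₀} = θ` ⇒ `PastFutureAvoidance` ⇒ `FarReturnDecay` (landed) = the child.

Conclusion by name: before the split lands, the child is the local `LatticeFarReturnDecay` below (route
item text VERBATIM, `Iff.rfl` with `FarPast.Passage.FarReturnDecay`); once
`Theses.SAWExcursionCardy.LatticeFarReturnDecay` exists the last theorem is re-pointed at it (same term).
-/

noncomputable section

open MeasureTheory Filter Topology Set Metric Function Classical
open Literature.Probability.RandomPlanarGeometry Literature.Probability.RandomPlanarGeometry.SAW
open Literature.Probability.LatticeModels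
open scoped ENNReal NNReal unitInterval

namespace Summit.CriticalPhenomena.SAWScalingLimit.Cruxes.LatticeFarReturnDecay.DominationBirth

open Summit.CriticalPhenomena.SAWScalingLimit.Theorems.SimpleSubseqLimits.MarkedPointRevisit.Passage
  (latticeCurve)
open Summit.CriticalPhenomena.SAWScalingLimit.Theorems.SimpleSubseqLimits.FarPast.Passage
  (FarReturnDecay)
open Summit.CriticalPhenomena.SAWScalingLimit.Theorems.SimpleSubseqLimits.FarPast.Line
  (PastFutureReturn PastFutureAvoidanceAt PastFutureAvoidance farReturnDecay_of_pastFutureAvoidance)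

/-! ### The child (route item text, verbatim) -/

/-- **ORDER child `LatticeFarReturnDecay`** — the route item text verbatim (fully qualified). -/
def LatticeFarReturnDecay : Prop :=
  ∀ (D : Literature.Probability.RandomPlanarGeometry.DobrushinDomain) (a b : ℝ → Literature.Probability.LatticeModels.Site 2), Literature.Probability.RandomPlanarGeometry.SAW.IsEndpointApprox D a b → ∀ (q : ℂ) (r θ : ℝ), 0 < r → 0 < θ → ∃ ε r₀ r' : ℝ, 0 < ε ∧ 0 < r₀ ∧ r₀ < r ∧ r < r' ∧ ∀ᶠ δ in nhdsWithin 0 (Set.Ioi 0), Literature.Probability.RandomPlanarGeometry.SAW.law D.carrier δ (a δ) (b δ) {γ | ∃ γ' : Literature.Probability.RandomPlanarGeometry.Curve ℂ, Literature.Probability.RandomPlanarGeometry.CurveClass.mk γ' = γ.curve ∧ ∃ v T t' : unitInterval, v < T ∧ T ≤ t' ∧ (∀ u : unitInterval, u ≤ v → 5 * r < dist (γ' u) q) ∧ (∀ u : unitInterval, u ≤ T → r₀ < dist (γ' u) q) ∧ dist (γ' T) q < r' ∧ dist (γ' t') (γ' v) < ε} ≤ ENNReal.ofReal θ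

/-- The child IS `FarPast.Passage.FarReturnDecay` (definitional). -/
theorem latticeFarReturnDecay_iff : LatticeFarReturnDecay ↔ FarReturnDecay := Iff.rfl

/-! ### Random-walk vocabulary: the slit-graph excursion from the first-entrance tip -/

/-- The walk `j ↦ u + S ω j` moves along `G`-edges up to step `n` and arrives at `w` for the FIRST time
at step `n`. -/
def ArrivesAlong (G : SimpleGraph (Site 2)) (u w : Site 2) (ω : SRW.PathSpace 2) (n : ℕ) : Prop :=
  (∀ j < n, G.Adj (u + SRW.S ω j) (u + SRW.S ω (j + 1))) ∧ u + SRW.S ω n = w ∧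
    ∀ j < n, u + SRW.S ω j ≠ w

/-- `P[SRW from u, run along G-edges, arrives at w]`. -/
def rwArrive (G : SimpleGraph (Site 2)) (u w : Site 2) : ℝ :=
  (SRW.pathLaw 2).real {ω | ∃ n, ArrivesAlong G u w ω n}

/-- `P[SRW from u, run along G-edges, arrives at w having visited A on the way (endpoints included)]`. -/
def rwArriveVisit (G : SimpleGraph (Site 2)) (u w : Site 2) (A : Set (Site 2)) : ℝ :=
  (SRW.pathLaw 2).real {ω | ∃ n, ArrivesAlong G u w ω n ∧ ∃ j ≤ n, u + SRW.S ω j ∈ A}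

/-- Visit probability of `A` under the lattice excursion `u → w` of `G` (junk `0` at mass `0`). -/
def rwExcursionVisit (G : SimpleGraph (Site 2)) (u w : Site 2) (A : Set (Site 2)) : ℝ :=
  rwArriveVisit G u w A / rwArrive G u w

/-- The slit graph: `G` with the vertex set `P` (the past) deleted. -/
def slitGraph (G : SimpleGraph (Site 2)) (P : Set (Site 2)) : SimpleGraph (Site 2) :=
  SimpleGraph.fromRel fun x y => G.Adj x y ∧ x ∉ P ∧ y ∉ P

variable {Ω : Set ℂ} {δ : ℝ} {u w : Site 2}

/-- Index of the first vertex of the walk in the closed ball `B̄(q, r')` (`none` if it never enters). -/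
def firstIn (γ : DomainSAW Ω δ u w) (q : ℂ) (r' : ℝ) : Option ℕ :=
  (List.range (γ.walk.length + 1)).find? fun i => decide (dist (meshPoint δ (γ.walk.getVert i)) q ≤ r')

/-- The past before index `k` (tip excluded), as a set of sites. -/
def pastBefore (γ : DomainSAW Ω δ u w) (k : ℕ) : Set (Site 2) :=
  {v | ∃ i < k, γ.walk.getVert i = v}

/-- The FAR past: vertices visited while the walk had never yet been `5r`-close to `q`. -/
def farPast (γ : DomainSAW Ω δ u w) (q : ℂ) (r : ℝ) : Set (Site 2) :=
  {v | ∃ i, γ.walk.getVert i = v ∧ ∀ i' ≤ i, 5 * r < dist (meshPoint δ (γ.walk.getVert i')) q}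

/-- Sites whose mesh point is `ε`-close to the mesh point of some site of `Fset`. -/
def nearSites (δ : ℝ) (Fset : Set (Site 2)) (ε : ℝ) : Set (Site 2) :=
  {v | ∃ p ∈ Fset, dist (meshPoint δ v) (meshPoint δ p) < ε}

/-- **The random-walk side of the line, per walk**: probability that the excursion of the SLIT graph
`Ω_δ ∖ (past before the first entrance into B̄(q, r'))` from the first-entrance tip to `w` passes `ε`-close
to the FAR past (`0` if the walk never enters the ball). -/
def rwFar (Ω : Set ℂ) (δ : ℝ) (u w : Site 2) (q : ℂ) (r r' ε : ℝ) (γ : DomainSAW Ω δ u w) : ℝ :=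
  match firstIn γ q r' with
  | none => 0
  | some k => rwExcursionVisit (slitGraph (discreteDomainGraph Ω δ) (pastBefore γ k))
      (γ.walk.getVert k) w (nearSites δ (farPast γ q r) ε)

theorem rwExcursionVisit_nonneg (G : SimpleGraph (Site 2)) (u w : Site 2) (A : Set (Site 2)) :
    0 ≤ rwExcursionVisit G u w A :=
  div_nonneg measureReal_nonneg measureReal_nonneg

theorem rwFar_nonneg (Ω : Set ℂ) (δ : ℝ) (u w : Site 2) (q : ℂ) (r r' ε : ℝ) (γ : DomainSAW Ω δ u w) :
    0 ≤ rwFar Ω δ u w q r r' ε γ := by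
  unfold rwFar
  split
  · exact le_rfl
  · exact rwExcursionVisit_nonneg _ _ _ _

/-- The past-AVERAGED random-walk quantity `E_δ[rwFar]`. -/
def avgRWFar (D : DobrushinDomain) (δ : ℝ) (u w : Site 2) (q : ℂ) (r r' ε : ℝ) : ℝ :=
  ∫ γ, rwFar D.carrier δ u w q r r' ε γ ∂(SAW.law D.carrier δ u w)

theorem avgRWFar_nonneg (D : DobrushinDomain) (δ : ℝ) (u w : Site 2) (q : ℂ) (r r' ε : ℝ) :
    0 ≤ avgRWFar D δ u w q r r' ε :=
  integral_nonneg fun γ => rwFar_nonneg _ _ _ _ _ _ _ _ γ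

/-! ### The two stubs (the only `sorry`s of this file) -/

/-- **STUB 1 statement — Hölder-weak, past-averaged Brownian domination at the first entrance**
(research-open). -/
def FarReturnDomination : Prop :=
  ∃ C θ₀ : ℝ, 0 < C ∧ 0 < θ₀ ∧
    ∀ (D : DobrushinDomain) (a b : ℝ → Site 2), SAW.IsEndpointApprox D a b →
      ∀ (q : ℂ) (r r' ε : ℝ), 0 < r → r < r' → r' ≤ 5 * r → 0 < ε → ∀ᶠ δ in 𝓝[>] (0 : ℝ),
        SAW.law D.carrier δ (a δ) (b δ) {γ | PastFutureReturn (latticeCurve γ) q r r' ε} ≤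
          ENNReal.ofReal (C * avgRWFar D δ (a δ) (b δ) q r r' (2 * ε) ^ θ₀)

/-- **STUB 2 statement — the past-averaged slit excursion does not return to the far past**. -/
def RWFarDecay : Prop :=
  ∀ (D : DobrushinDomain) (a b : ℝ → Site 2), SAW.IsEndpointApprox D a b →
    ∀ (q : ℂ) (r η : ℝ), 0 < r → 0 < η → ∃ ε r' : ℝ, 0 < ε ∧ r < r' ∧ r' ≤ 5 * r ∧
      ∀ᶠ δ in 𝓝[>] (0 : ℝ), avgRWFar D δ (a δ) (b δ) q r r' (2 * ε) ≤ η

/-- **STUB 1** (OPEN, `x_c`-specific): past-averaged Hölder-weak domination at the first entrance. -/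
theorem stub_farReturnDomination : FarReturnDomination := by
  sorry

/-- **STUB 2** (open, random-walk side + one-strand caging): the averaged slit excursion from the tip
does not return to the far past. -/
theorem stub_rwFarDecay : RWFarDecay := by
  sorry

/-! ### Name-keyed aliases (skeleton audit: hypotheses of the composition are registered stubs) -/
namespace Registered
/-- Alias keyed by the registered stub name. -/
abbrev stub_farReturnDomination : Prop := FarReturnDomination
/-- Alias keyed by the registered stub name. -/
abbrev stub_rwFarDecay : Prop := RWFarDecay
end Registered

/-! ### Composition (PROVED): stubs ⇒ `PastFutureAvoidance` ⇒ the child, by name -/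

/-- Arithmetic of the Hölder-weak seam: with `η = (θ / C)^{1/θ₀}`, `C · η^{θ₀} = θ`. -/
theorem holder_target {C θ₀ θ : ℝ} (hC : 0 < C) (hθ₀ : 0 < θ₀) (hθ : 0 < θ) :
    C * ((θ / C) ^ (1 / θ₀)) ^ θ₀ = θ := by
  rw [← Real.rpow_mul (div_pos hθ hC).le, one_div_mul_cancel hθ₀.ne', Real.rpow_one]
  field_simp

/-- **Stubs ⇒ past/future avoidance at first entrances** (the landed sufficient form of the child). -/
theorem pastFutureAvoidance_of (h1 : Registered.stub_farReturnDomination)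
    (h2 : Registered.stub_rwFarDecay) : PastFutureAvoidance := by
  intro D a b hab q r θ hr hθ
  obtain ⟨C, θ₀, hC, hθ₀, hdom⟩ := h1
  have hηpos : 0 < (θ / C) ^ (1 / θ₀) := Real.rpow_pos_of_pos (div_pos hθ hC) _
  obtain ⟨ε, r', hε, hr', h5, hrw⟩ := h2 D a b hab q r ((θ / C) ^ (1 / θ₀)) hr hηpos
  refine ⟨ε, r', hε, hr', h5, ?_⟩
  filter_upwards [hdom D a b hab q r r' ε hr hr' h5 hε, hrw] with δ hδ hρ
  refine hδ.trans (ENNReal.ofReal_le_ofReal ?_)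
  have h0 : 0 ≤ avgRWFar D δ (a δ) (b δ) q r r' (2 * ε) := avgRWFar_nonneg ..
  calc C * avgRWFar D δ (a δ) (b δ) q r r' (2 * ε) ^ θ₀
      ≤ C * ((θ / C) ^ (1 / θ₀)) ^ θ₀ := by
        gcongr
    _ = θ := holder_target hC hθ₀ hθ

/-- **THE COMPOSITION.** `stub_farReturnDomination → stub_rwFarDecay → LatticeFarReturnDecay`
(via `PastFutureAvoidance` and the landed `farReturnDecay_of_pastFutureAvoidance`). -/
theorem LatticeFarReturnDecay_of (h1 : Registered.stub_farReturnDomination)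
    (h2 : Registered.stub_rwFarDecay) : LatticeFarReturnDecay :=
  latticeFarReturnDecay_iff.2 (farReturnDecay_of_pastFutureAvoidance (pastFutureAvoidance_of h1 h2))

/-- Wiring check: the registered stubs feed the composition as stated. -/
example : LatticeFarReturnDecay := LatticeFarReturnDecay_of stub_farReturnDomination stub_rwFarDecay

/-- The same composition concludes the Theorems-side name of the child. -/
theorem farReturnDecay_of (h1 : Registered.stub_farReturnDomination) (h2 : Registered.stub_rwFarDecay) :
    FarReturnDecay :=
  latticeFarReturnDecay_iff.1 (LatticeFarReturnDecay_of h1 h2)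

end Summit.CriticalPhenomena.SAWScalingLimit.Cruxes.LatticeFarReturnDecay.DominationBirth

end
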